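import Summits.ResolutionOfSingularities.ResolutionOfSingularities.Theorems.PurelyInseparableDim4ResConeGoodInvariant
import Summits.ResolutionOfSingularities.ResolutionOfSingularities.Theorems.PurelyInseparableDim4ResConePrimeWeights
import Summits.ResolutionOfSingularities.ResolutionOfSingularities.Theorems.PurelyInseparableDim4ResConePairConfinedRepresentation
import HarnessLib
import HarnessLib.Audit.Tags

/-!
# Purely inseparable four-folds — EVERY `(p, p−1)` BINARY-CONE TAIL IS EVENTUALLY GOOD, hence has an HONEST PAIR-CONFINED
# PASSIVE-FREE PARTNER, FOR EVERY PRIME `p` (K2(p) lane, SLICE C, the `(p, p−1)` rung reduced to the two-letter game;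
# file-holder res-dim4-p-5 g5)

[OURS · counted 0 · cell `res-dim4-pi` · K2(p) lane, slice C (general-`p` programme; bus plan res-dim4-p-5 g5 2026-08-29 08:32Z) · seat p-5 g5.]
Nothing here proves K2(p) for any `p`, `NoIsolatedTrap p p` or resolution of singularities in dimension ≥ 4 / characteristic `p` — NOT
proved; this REDUCES slice C(p, p−1) of OUR frame to pair-confined passive-free tails (the two-letter game; at `p = 5` killed by
res-dim4-p-5 g4's `no_pair_tail_four_five`, open for `p ≥ 7`).  AI kernel work, weaker than expert review.

GOOD(m) := at most two boundary letters at `m` and every boundary pair TT (`…ResConeGoodInvariant`).  THE ARGUMENT (shade `d = p − 1`):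
* §1 LEDGER (`prime_weights_laws`): the newborn weighs `|r_m| − 1`, so `|r_{m+1}| ≥ |r_m| − 1 + (kept mass)`: a kept boundary letter makes
  `|r|` non-decreasing, two kept letters make it increase (`degree_succ_ge_of_kept`, `degree_succ_gt_of_kept_two`); hence runs of states
  with ≥ 3 boundary letters are short and states with ≤ 2 boundary letters recur (`exists_le_two_letters`);
* §2 NO-GOOD DYNAMICS (`…GoodInvariant`): if GOOD fails at `t` and `t + 1`, a 2-letter state `{newborn, z}` (TT failing) or a 3-letter state
  `{a, b, z}` with TT(a, b) steps to a state of one of these two shapes WITH THE SAME `z`, KEEPING `z` (keeping the newborn of a degenerate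
  pair keeps `z` — `kept_of_kept_newborn`; every other continuation is GOOD by `tt_transport_kept` / `tt_of_satellite`);
* §3 **`eventually_good_prime (p)`** — if GOOD never held from some time on, `z` would be kept for ever, `|r|` would be non-decreasing and
  would rise at every satellite step (which keeps the newborn too), and FT (`exists_satellite_ge`) supplies infinitely many satellites —
  against `|r| ≤ p − 1`.  So every constant-shade-`(p−1)` `e_G = 2` tail is GOOD from some time on (and GOOD is invariant, `good_succ`);
* §4 **`pair_representation_prime (p)`** — HENCE (res-dim4-p-5 g5 `pair_representation_of_support_le_two`, res-dim4-typ-1 g4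
  `pair_virtual_step`) every such tail has an HONEST witnessed pair-confined passive-free partner with the same weights renamed.
So, for every prime `p`: slice C(p, p−1) ⟺ «no pair-confined passive-free constant-shade-`(p−1)` `e_G = 2` tail».  At `d < p − 1` the
mass CAN drop (newborn `|r| + d − p`) and permanent boundary letters exist (the B∞ phenomenon of `(5,3)`): not treated here.
[cite: CossartJannsenSaito2020, Thm. 3.10(4), Thm. 3.14, Thm. 9.3, Lemma 13.2] [cite: HauserPerlega2019PRIMS, §2 (transform D′ of D)]
bears_on: LADDER-RESOLUTION:D157-DOOR2 (res-dim4-pi · K2(p) = `RidgeBudget.NoAboveFloorTrap p p` · slice C(p, p−1) ⟹ two-letter game).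
Supports stmt-ResolutionOfSingularities-16155 (helper).
-/

set_option linter.dupNamespace false -- mandated namespace of this single-conjunct summit

noncomputable section

namespace Summit.ResolutionOfSingularities.ResolutionOfSingularities.Theorems.PIDim4

namespace ResCone

open MvPolynomial Finset
open Literature.AlgebraicGeometry.Resolution
open Literature.AlgebraicGeometry.Resolution.CentreBlowup
open Literature.AlgebraicGeometry.Resolution.Hauser2010
open Literature.AlgebraicGeometry.Resolution.HauserPerlega2019

variable {K : Type} [Field K] [DecidableEq K] (p : ℕ) [Fact p.Prime]

/-! ## §1 The `(p, p−1)` ledger: kept letters push the mass up -/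

section Ledger

/-- **A KEPT BOUNDARY LETTER MAKES THE MASS NON-DECREASING** (shade `p − 1`): `|r_m| − 1 + r_m z ≤ |r_{m+1}|` for `z` kept at step `m`.
[OURS · bookkeeping] [cite: HauserPerlega2019PRIMS, §2 (transform D′ of D)] -/
theorem degree_succ_ge_of_kept {c : ℕ → State K} {j : ℕ → Fin 4} {b : ℕ → Fin 4 → K}
    (hc : ∀ k, IsIsolated p (c k).F ∧ Step0 p (c k) (c (k + 1))) (hw : FreeTail.IsWitnessedChain p c j b)
    (hr0 : ∀ e ∈ (c 0).F.support, (c 0).r ≤ e) (hfloor : ∀ k, ordZero (c k).F ≠ p) {k₀ d : ℕ} (hd : d + 1 = p)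
    (hshade : ∀ k, k₀ ≤ k → (c k).shade = (d : ℕ∞)) {m : ℕ} (hm : k₀ ≤ m) {z : Fin 4} (hz : z ≠ j m) (hbz : b m z = 0) :
    (c m).r.degree - 1 + (c m).r z ≤ (c (m + 1)).r.degree := by
  obtain ⟨-, hlaw, -, -, -⟩ := prime_weights_laws p hc hw hr0 hfloor hd hshade
  have hnew : (c (m + 1)).r (j m) = (c m).r.degree - 1 := by
    rw [hlaw m hm, Finsupp.coe_update, Function.update_self]
  have hkept : (c (m + 1)).r z = (c m).r z := by
    rw [succ_r_apply_of_ne' p hc hw hfloor m hz, if_pos hbz]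
  have h := apply_add_apply_le_degree ((c (m + 1)).r) (Ne.symm hz)
  omega

/-- **TWO KEPT BOUNDARY LETTERS MAKE THE MASS INCREASE** (shade `p − 1`). [OURS · bookkeeping] [cite: HauserPerlega2019PRIMS, §2 (transform D′ of D)] -/
theorem degree_succ_ge_of_kept_two {c : ℕ → State K} {j : ℕ → Fin 4} {b : ℕ → Fin 4 → K}
    (hc : ∀ k, IsIsolated p (c k).F ∧ Step0 p (c k) (c (k + 1))) (hw : FreeTail.IsWitnessedChain p c j b)
    (hr0 : ∀ e ∈ (c 0).F.support, (c 0).r ≤ e) (hfloor : ∀ k, ordZero (c k).F ≠ p) {k₀ d : ℕ} (hd : d + 1 = p)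
    (hshade : ∀ k, k₀ ≤ k → (c k).shade = (d : ℕ∞)) {m : ℕ} (hm : k₀ ≤ m) {z z' : Fin 4} (hzz' : z ≠ z') (hz : z ≠ j m)
    (hbz : b m z = 0) (hz' : z' ≠ j m) (hbz' : b m z' = 0) :
    (c m).r.degree - 1 + (c m).r z + (c m).r z' ≤ (c (m + 1)).r.degree := by
  obtain ⟨-, hlaw, -, -, -⟩ := prime_weights_laws p hc hw hr0 hfloor hd hshade
  have hnew : (c (m + 1)).r (j m) = (c m).r.degree - 1 := by
    rw [hlaw m hm, Finsupp.coe_update, Function.update_self]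
  have hkept : (c (m + 1)).r z = (c m).r z := by
    rw [succ_r_apply_of_ne' p hc hw hfloor m hz, if_pos hbz]
  have hkept' : (c (m + 1)).r z' = (c m).r z' := by
    rw [succ_r_apply_of_ne' p hc hw hfloor m hz', if_pos hbz']
  have h := apply_add_apply_add_apply_le_degree ((c (m + 1)).r) (Ne.symm hz) (Ne.symm hz') hzz'
  omega

/-- **STATES WITH AT MOST TWO BOUNDARY LETTERS RECUR** (shade `p − 1`): a state with ≥ 3 boundary letters comes from a step that kept ≥ 2
letters, which raises `|r|`; `|r| ≤ p − 1`. [OURS] [cite: CossartJannsenSaito2020, Thm. 3.14, Lemma 13.2] -/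
theorem exists_le_two_letters {c : ℕ → State K} {j : ℕ → Fin 4} {b : ℕ → Fin 4 → K}
    (hc : ∀ k, IsIsolated p (c k).F ∧ Step0 p (c k) (c (k + 1))) (hw : FreeTail.IsWitnessedChain p c j b)
    (hr0 : ∀ e ∈ (c 0).F.support, (c 0).r ≤ e) (hfloor : ∀ k, ordZero (c k).F ≠ p) {k₀ d : ℕ} (hd : d + 1 = p)
    (hshade : ∀ k, k₀ ≤ k → (c k).shade = (d : ℕ∞)) {N : ℕ} (hN : k₀ ≤ N) :
    ∃ m, N ≤ m ∧ ∃ x y : Fin 4, ∀ i, i ≠ x → i ≠ y → (c m).r i = 0 := by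
  obtain ⟨-, -, -, -, hdeg, -, -⟩ := prime_weights_laws p hc hw hr0 hfloor hd hshade
  by_contra hno
  push Not at hno
  -- every step from `N` on keeps two letters of weight ≥ 1, so `|r_{N+n}| ≥ |r_N| + n`
  have hgrow : ∀ n, (c N).r.degree + n ≤ (c (N + n)).r.degree := by
    intro n
    induction n with
    | zero => simp
    | succ n ih =>
      -- three boundary letters at `N + n + 1`: two of them are kept letters of step `N + n`
      have h3 := hno (N + n + 1) (by omega)
      obtain ⟨i₁, hi₁j, -, hi₁⟩ := h3 (j (N + n)) (j (N + n))
      obtain ⟨i₂, hi₂j, hi₂i₁, hi₂⟩ := h3 (j (N + n)) i₁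
      have hk : ∀ i, i ≠ j (N + n) → (c (N + n + 1)).r i ≠ 0 → b (N + n) i = 0 ∧ 1 ≤ (c (N + n)).r i := by
        intro i hi hri
        rw [succ_r_apply_of_ne' p hc hw hfloor (N + n) hi] at hri
        by_cases hb : b (N + n) i = 0
        · rw [if_pos hb] at hri; exact ⟨hb, by omega⟩
        · rw [if_neg hb] at hri; exact absurd rfl hri
      obtain ⟨hb₁, hr₁⟩ := hk i₁ hi₁j hi₁
      obtain ⟨hb₂, hr₂⟩ := hk i₂ hi₂j hi₂
      have h := degree_succ_ge_of_kept_two p hc hw hr0 hfloor hd hshade (show k₀ ≤ N + n by omega) (Ne.symm hi₂i₁) hi₁j hb₁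
        hi₂j hb₂
      have h2 : 2 ≤ (c (N + n)).r.degree := by
        have := apply_add_apply_le_degree ((c (N + n)).r) (Ne.symm hi₂i₁); omega
      rw [show N + (n + 1) = N + n + 1 by ring]
      omega
  have h1 := hgrow (d + 1)
  have h2 := hdeg (N + (d + 1)) (by omega)
  omega

end Ledger

/-! ## §2–§3 Every `(p, p−1)` binary-cone tail is eventually GOOD -/

section Good

variable [CharP K p]

/-- **EVERY `(p, p−1)` BINARY-CONE TAIL IS EVENTUALLY GOOD.**  On a witnessed isolated above-floor `Step0 p` chain with `x^{r₀} ∣ F₀`,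
constant shade `d = p − 1` and `e_G ≡ 2` from `k₀`, there is `M ≥ k₀` such that at every `m ≥ M` there are at most two boundary letters
and every pair of boundary letters is TT. [OURS] [cite: CossartJannsenSaito2020, Thm. 3.10(4), Thm. 3.14, Thm. 9.3, Lemma 13.2] -/
theorem eventually_good_prime {c : ℕ → State K} {j : ℕ → Fin 4} {b : ℕ → Fin 4 → K}
    (hc : ∀ k, IsIsolated p (c k).F ∧ Step0 p (c k) (c (k + 1))) (hw : FreeTail.IsWitnessedChain p c j b)
    (hr0 : ∀ e ∈ (c 0).F.support, (c 0).r ≤ e) (hfloor : ∀ k, ordZero (c k).F ≠ p) {k₀ d : ℕ} (hd : d + 1 = p)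
    (hshade : ∀ k, k₀ ≤ k → (c k).shade = (d : ℕ∞)) (he : ∀ k, k₀ ≤ k → Module.finrank K (resVertex (c k)) = 2) :
    ∃ M, k₀ ≤ M ∧ ∀ m, M ≤ m →
      (∃ x y : Fin 4, ∀ i, i ≠ x → i ≠ y → (c m).r i = 0) ∧
      (∀ x y : Fin 4, x ≠ y → 1 ≤ (c m).r x → 1 ≤ (c m).r y →
        ∀ v ∈ resVertex (c m), v x = 0 → v y = 0 → v = 0) := by
  have hshade' : ∀ k, k₀ ≤ k → (c k).shade = ((d : ℕ) : ℕ∞) := hshade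
  obtain ⟨-, -, -, -, hdeg, -, -⟩ := prime_weights_laws p hc hw hr0 hfloor hd hshade
  have hlaw := fun m i (hi : i ≠ j m) => succ_r_apply_of_ne' p hc hw hfloor m hi
  have hnew1 := fun m => one_le_succ_r_chart p hc hw hfloor m
  -- GOOD propagates, so it suffices to find ONE good time `≥ k₀ + 1`
  by_contra hnone
  have hbad : ∀ m, k₀ + 1 ≤ m → ¬ ((∃ x y : Fin 4, ∀ i, i ≠ x → i ≠ y → (c m).r i = 0) ∧
      (∀ x y : Fin 4, x ≠ y → 1 ≤ (c m).r x → 1 ≤ (c m).r y →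
        ∀ v ∈ resVertex (c m), v x = 0 → v y = 0 → v = 0)) := by
    intro m hm hgood
    apply hnone
    refine ⟨m, by omega, fun m' hm' => ?_⟩
    -- propagate GOOD from `m` to `m'`
    obtain ⟨n, rfl⟩ := Nat.exists_eq_add_of_le hm'
    clear hm'
    induction n with
    | zero => simpa using hgood
    | succ n ih =>
      obtain ⟨m₀, rfl⟩ : ∃ m₀, m = m₀ + 1 := ⟨m - 1, by omega⟩
      have h := good_succ p hc hw hr0 hfloor hshade' he (m := m₀ + n) (by omega)
        (by rw [show m₀ + n + 1 = m₀ + 1 + n by ring]; exact ih.2)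
      rw [show m₀ + 1 + (n + 1) = m₀ + n + 2 by ring]
      exact h
  -- a single boundary letter, or none, is GOOD: so under `hbad` every state `≥ k₀ + 1` has two letters of weight ≥ 1
  have htwo : ∀ m, k₀ + 1 ≤ m → ∀ x : Fin 4, (∀ i, i ≠ x → (c m).r i = 0) → False := by
    intro m hm x hx
    refine hbad m hm ⟨⟨x, x, fun i hi _ => hx i hi⟩, fun a a' haa' ha ha' => ?_⟩
    by_cases hax : a = x
    · have := hx a' (by rw [← hax]; exact Ne.symm haa'); omega
    · have := hx a hax; omega
  -- (1) ENTRY: a time `m₀ + 1 ≥ k₀ + 1` with exactly two boundary letters `{j m₀, z}` and failing TT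
  obtain ⟨m₁, hm₁, x, y, hxy⟩ := exists_le_two_letters p hc hw hr0 hfloor hd hshade (N := k₀ + 1) (by omega)
  obtain ⟨m₀, rfl⟩ : ∃ m₀, m₁ = m₀ + 1 := ⟨m₁ - 1, by omega⟩
  -- the newborn `j m₀` is a boundary letter; let `z` be the other one
  have hjxy : j m₀ = x ∨ j m₀ = y := by
    by_contra hno; push Not at hno
    have := hxy (j m₀) hno.1 hno.2; have := hnew1 m₀; omega
  obtain ⟨z, hzj, hz1, hothers⟩ : ∃ z : Fin 4, z ≠ j m₀ ∧ 1 ≤ (c (m₀ + 1)).r z ∧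
      ∀ i, i ≠ j m₀ → i ≠ z → (c (m₀ + 1)).r i = 0 := by
    -- the other letter of `{x, y}` has weight ≥ 1 (else `j m₀` is alone: GOOD)
    have key : ∀ z : Fin 4, (∀ i, i ≠ j m₀ → i ≠ z → (c (m₀ + 1)).r i = 0) →
        ∃ z : Fin 4, z ≠ j m₀ ∧ 1 ≤ (c (m₀ + 1)).r z ∧ ∀ i, i ≠ j m₀ → i ≠ z → (c (m₀ + 1)).r i = 0 := by
      intro z hz
      by_cases hzj : z = j m₀
      · exact (htwo (m₀ + 1) hm₁ (j m₀) fun i hi => hz i hi (by rw [hzj]; exact hi)).elim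
      · by_cases hz0 : (c (m₀ + 1)).r z = 0
        · exact (htwo (m₀ + 1) hm₁ (j m₀) fun i hi => by
            by_cases hiz : i = z
            · rw [hiz]; exact hz0
            · exact hz i hi hiz).elim
        · exact ⟨z, hzj, by omega, hz⟩
    rcases hjxy with h | h
    · exact key y fun i hi hi' => hxy i (by rw [← h]; exact hi) hi'
    · exact key x fun i hi hi' => hxy i hi' (by rw [← h]; exact hi)
  -- (2) THE INVARIANT along `n ↦` time `m₀ + n + 1` (`noGood_step`), with `z` fixed
  have hm₀ : k₀ ≤ m₀ := by omega
  have hP : ∀ n, ((z ≠ j (m₀ + n) ∧ 1 ≤ (c (m₀ + n + 1)).r z ∧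
        ∀ i, i ≠ j (m₀ + n) → i ≠ z → (c (m₀ + n + 1)).r i = 0) ∨
      (∃ a b' : Fin 4, a ≠ b' ∧ a ≠ z ∧ b' ≠ z ∧ 1 ≤ (c (m₀ + n + 1)).r a ∧ 1 ≤ (c (m₀ + n + 1)).r b' ∧
        1 ≤ (c (m₀ + n + 1)).r z ∧ (∀ i, i ≠ a → i ≠ b' → i ≠ z → (c (m₀ + n + 1)).r i = 0) ∧
        ∀ v ∈ resVertex (c (m₀ + n + 1)), v a = 0 → v b' = 0 → v = 0)) := by
    intro n
    induction n with
    | zero => exact Or.inl ⟨by simpa using hzj, by simpa using hz1, by simpa using hothers⟩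
    | succ n ih =>
      have h := (noGood_step p hc hw hr0 hfloor hshade' he (m := m₀ + n) (by omega) ih (hbad _ (by omega))
        (hbad _ (by omega))).2
      rw [show m₀ + (n + 1) = m₀ + n + 1 by ring]
      exact h
  have hkept : ∀ n, z ≠ j (m₀ + n + 1) ∧ b (m₀ + n + 1) z = 0 := fun n =>
    (noGood_step p hc hw hr0 hfloor hshade' he (m := m₀ + n) (by omega) (hP n) (hbad _ (by omega)) (hbad _ (by omega))).1
  have hz1' : ∀ n, 1 ≤ (c (m₀ + n + 1)).r z := fun n => by
    rcases hP n with ⟨-, h, -⟩ | ⟨_, _, -, -, -, -, -, h, -, -⟩ <;> exact h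
  -- (3) the mass is non-decreasing and rises at every satellite step
  have hmono : ∀ n, (c (m₀ + n + 1)).r.degree ≤ (c (m₀ + n + 2)).r.degree := by
    intro n
    have h := degree_succ_ge_of_kept p hc hw hr0 hfloor hd hshade (m := m₀ + n + 1) (by omega) (hkept n).1 (hkept n).2
    rw [show m₀ + n + 1 + 1 = m₀ + n + 2 by ring] at h
    have h1 := hz1' n
    omega
  have hmono' : ∀ s n, (c (m₀ + s + 1)).r.degree ≤ (c (m₀ + s + n + 1)).r.degree := by
    intro s n
    induction n with
    | zero => simp
    | succ n ih =>
      have h := hmono (s + n)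
      rw [show m₀ + (s + n) + 1 = m₀ + s + n + 1 by ring, show m₀ + (s + n) + 2 = m₀ + s + (n + 1) + 1 by ring] at h
      exact ih.trans h
  have hstrict : ∀ n, FreeTail.IsSatellite j b (m₀ + n + 1) →
      (c (m₀ + n + 2)).r.degree + 1 ≤ (c (m₀ + n + 3)).r.degree := by
    intro n hsat
    -- step `m₀ + n + 2` keeps the newborn `j (m₀ + n + 1)` (satellite) and `z`
    have hℓz : z ≠ j (m₀ + n + 1) := (hkept n).1
    have hk1 := hkept (n + 1)
    rw [show m₀ + (n + 1) + 1 = m₀ + n + 2 by ring] at hk1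
    have h := degree_succ_ge_of_kept_two p hc hw hr0 hfloor hd hshade (m := m₀ + n + 2) (by omega) hℓz hk1.1 hk1.2
      hsat.1.symm hsat.2
    rw [show m₀ + n + 2 + 1 = m₀ + n + 3 by ring] at h
    have h1 := hz1' (n + 1)
    have h2 := one_le_succ_r_chart p hc hw hfloor (m₀ + n + 1)
    rw [show m₀ + (n + 1) + 1 = m₀ + n + 2 by ring] at h1
    rw [show m₀ + n + 1 + 1 = m₀ + n + 2 by ring] at h2
    omega
  -- (4) FT: infinitely many satellites ⇒ unbounded mass
  have hgrow : ∀ q, ∃ s, (c (m₀ + 1)).r.degree + q ≤ (c (m₀ + s + 1)).r.degree := by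
    intro q
    induction q with
    | zero => exact ⟨0, by simp⟩
    | succ q ih =>
      obtain ⟨s, hs⟩ := ih
      obtain ⟨k, hk, hsat⟩ := exists_satellite_ge p hc hw (m₀ + s + 1)
      obtain ⟨n, rfl⟩ : ∃ n, k = m₀ + n + 1 := ⟨k - m₀ - 1, by omega⟩
      refine ⟨n + 2, ?_⟩
      have h1 := hmono' s (n - s)
      rw [show m₀ + s + (n - s) + 1 = m₀ + n + 1 by omega] at h1
      have h2 := hmono n
      have h3 := hstrict n hsat
      rw [show m₀ + (n + 2) + 1 = m₀ + n + 3 by ring]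
      omega
  obtain ⟨s, hs⟩ := hgrow d
  have h1 := hdeg (m₀ + s + 1) (by omega)
  have h2 := hz1' 0
  have h3 : 1 ≤ (c (m₀ + 1)).r (j m₀) := hnew1 m₀
  have h4 := apply_add_apply_le_degree ((c (m₀ + 1)).r) hzj
  simp only [Nat.add_zero] at h2
  omega

/-- **EVERY `(p, p−1)` BINARY-CONE TAIL HAS AN HONEST PAIR-CONFINED PASSIVE-FREE PARTNER, every prime `p`.**  On a witnessed isolated
above-floor `Step0 p` chain with `x^{r₀} ∣ F₀`, constant shade `p − 1` and `e_G ≡ 2` from `k₀`: for every `N ≥ k₀` there are an entry time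
`kₑ ≥ N`, a pair `a ≠ a′` and an HONEST witnessed isolated above-floor `Step0 p` chain `c′` with `c′ 0 = c kₑ`, `x^{r₀} ∣ F₀`, constant shade
`p − 1`, `e_G ≡ 2`, chart letters in `{a, a′}`, the other two letters never boundary, and weights `(c′ t).r = (c (kₑ + t)).r ∘ π_t`
(`eventually_good_prime` + `pair_representation_of_support_le_two`).  So slice C(p, p−1) is the two-letter game. [OURS]
[cite: CossartJannsenSaito2020, Thm. 3.10(4), Thm. 3.14, Thm. 9.3] [cite: Hauser2010, §§F–G (chart expressions of a point blowup; cleaning)] -/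
theorem pair_representation_prime {c : ℕ → State K} {j : ℕ → Fin 4} {b : ℕ → Fin 4 → K}
    (hc : ∀ k, IsIsolated p (c k).F ∧ Step0 p (c k) (c (k + 1))) (hw : FreeTail.IsWitnessedChain p c j b)
    (hr0 : ∀ e ∈ (c 0).F.support, (c 0).r ≤ e) (hfloor : ∀ k, ordZero (c k).F ≠ p) {k₀ d : ℕ} (hd : d + 1 = p)
    (hshade : ∀ k, k₀ ≤ k → (c k).shade = (d : ℕ∞)) (he : ∀ k, k₀ ≤ k → Module.finrank K (resVertex (c k)) = 2)
    {N : ℕ} (hN : k₀ ≤ N) :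
    ∃ (kₑ : ℕ) (a a' : Fin 4) (c' : ℕ → State K) (j' : ℕ → Fin 4) (b' : ℕ → Fin 4 → K), N ≤ kₑ ∧ a ≠ a' ∧ c' 0 = c kₑ ∧
      (∀ t, ∃ π : Equiv.Perm (Fin 4), (c' t).r = Finsupp.mapDomain (Equiv.symm π) (c (kₑ + t)).r) ∧
      (∀ t, IsIsolated p (c' t).F ∧ Step0 p (c' t) (c' (t + 1))) ∧ FreeTail.IsWitnessedChain p c' j' b' ∧
      (∀ e ∈ (c' 0).F.support, (c' 0).r ≤ e) ∧ (∀ t, ordZero (c' t).F ≠ p) ∧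
      (∀ t, 0 ≤ t → (c' t).shade = (d : ℕ∞)) ∧ (∀ t, 0 ≤ t → Module.finrank K (resVertex (c' t)) = 2) ∧
      (∀ t, 0 ≤ t → (j' t = a ∨ j' t = a')) ∧ (∀ t, 0 ≤ t → ∀ i, i ≠ a → i ≠ a' → (c' t).r i = 0) := by
  obtain ⟨M, hM, hgood⟩ := eventually_good_prime p hc hw hr0 hfloor hd hshade he
  exact pair_representation_of_support_le_two p hc hw hr0 hfloor (k₀ := max M N)
    (fun k hk => hshade k (by omega)) (fun k hk => he k (by omega)) (fun k hk => (hgood k (by omega)).1) le_rfl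
    |>.imp fun kₑ ⟨a, a', c', j', b', hkₑ, h⟩ => ⟨a, a', c', j', b', (le_max_right M N).trans hkₑ, h⟩

end Good

end ResCone

end Summit.ResolutionOfSingularities.ResolutionOfSingularities.Theorems.PIDim4

end
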